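import Mathlib
import Literature.MathematicalPhysics.QuantumFieldTheory.Luscher2010.FlowExistenceProofs
import Summits.Ventures.LatticeQCDFlow.TrivializingMaps.JacobianFormula
import Summits.Ventures.LatticeQCDFlow.TrivializingMaps.DefectLogWeightMeasure
import Summits.Ventures.LatticeQCDFlow.TrivializingMaps.TruncatedMapLogWeight
import Summits.Ventures.LatticeQCDFlow.TrivializingMaps.TrivializingFlow
import Summits.Ventures.LatticeQCDFlow.TrivializingMaps.FlowCriterion
import Summits.Ventures.LatticeQCDFlow.TrivializingMaps.GaugeCovariance

/-!
# LatticeQCDFlow / TrivializingMaps — Lüscher §3–§4 results made unconditional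

HONEST FRAMING: exact (Metropolis-corrected) sampling algorithms for lattice gauge theory; figures
of merit are autocorrelation/cost numbers at stated couplings and volumes; no continuum-physics claim.

Venture `LatticeQCDFlow` (cell pub-lqcd), topic `TrivializingMaps`, row 31 (lean-2).  The theory-1 files
`DefectLogWeightMeasure`, `TruncatedMapLogWeight`, `TrivializingFlow` prove their targets conditionally on
the two cited §3 inputs of file A, `FlowGlobalExistence d L n` (§3.1) and `JacobianFormula d L n` (§3.2,
eq. (3.9)).  Both are now theorems — `Luscher2010.flowGlobalExistence_holds`
(`Literature/…/Luscher2010/FlowExistenceProofs.lean`) and `jacobianFormula_holds` (`JacobianFormula.lean`) —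
so the venture targets hold outright:

* `defectControlsLogWeight_holds : DefectControlsLogWeight d L n` (typed target R-T1-7c of `Truncation.lean`);
* `truncatedMapLogWeightBound_holds : TruncatedMapLogWeightBound d L n` (R-T1-7b);
* `trivializingFlowCriterion_holds : TrivializingFlowCriterion d L n` (file A's cited Prop, §4.1
  (4.1)–(4.3); lean-1's `trivializingFlowCriterion_of`);
* `isTrivializingMap_of_flowEquation'` — an exact solution of `𝓛_t S̃_t = S + Ċ_t` on `[0,1]` yields a
  trivializing time-one map; `isGaugeEquivariant_flowMap'` — gradient flows of gauge-invariant flow actions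
  are gauge equivariant;
* `exists_isTrivializingMap_flow_of_trivializingFlowExists` — Lüscher's §4.2 existence of trivializing
  FLOWS, now conditional ONLY on the PDE input `TrivializingFlowExists` (solvability of (4.5), App. E).
-/

noncomputable section

namespace Summit.Ventures.LatticeQCDFlow.TrivializingMaps

open Literature.MathematicalPhysics.QuantumFieldTheory
open Literature.MathematicalPhysics.QuantumFieldTheory.Luscher2010
open Summit.Ventures.LatticeQCDFlow.Exactness (IsGaugeEquivariant)
open scoped Matrix.Norms.Frobenius ContDiff

variable {d L n : ℕ}

/-- **R-T1-7c unconditionally**: a uniform defect `δ` of the trivializing-flow equation (4.5) controls the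
pulled-back log-weight of the time-one map (`ρ U ≤ e^{2δ} ρ U'`), for every smooth action and flow action on
`SU(n)^E` — Lüscher §4.1 in defect form, with §3.1 and (3.9) now proved.
[cite: Luscher2010Trivializing, §3.1, §3.2 eq. (3.9), §4.1 eqs. (4.1)–(4.3)] -/
theorem defectControlsLogWeight_holds : DefectControlsLogWeight d L n :=
  defectControlsLogWeight_of flowGlobalExistence_holds jacobianFormula_holds

/-- **R-T1-7b unconditionally**: the order-`N` truncated Lüscher map has log-weight oscillation
`≤ 2K/(N+2)` (sharp constant) whenever `|𝓥 S̃^{(N)}| ≤ K` — §4.5(c) made quantitative, with §3.1 and (3.9)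
now proved. [cite: Luscher2010Trivializing, §3.2 eq. (3.9), §4.5] -/
theorem truncatedMapLogWeightBound_holds : TruncatedMapLogWeightBound d L n :=
  truncatedMapLogWeightBound_of flowGlobalExistence_holds jacobianFormula_holds

/-- **File A's `TrivializingFlowCriterion` (§4.1, eqs. (4.1)–(4.3)) unconditionally** (lean-1's
`trivializingFlowCriterion_of` + `jacobianFormula_holds`). [cite: Luscher2010Trivializing, §4.1 eqs. (4.1)–(4.3)] -/
theorem trivializingFlowCriterion_holds : TrivializingFlowCriterion d L n :=
  trivializingFlowCriterion_of jacobianFormula_holds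

/-- **Exact solutions of the flow equation trivialize, unconditionally**: if `𝓛_t S̃_t = S + Ċ_t` on
`[0, 1] × SU(n)^E` and `Φ` integrates `-∂S̃_t`, then `Φ_1` is a trivializing map for `S`.
[cite: Luscher2010Trivializing, §4.1 eqs. (4.1)–(4.3), §4.2 eqs. (4.4)–(4.6)] -/
theorem isTrivializingMap_of_flowEquation' [NeZero L] (B : SuBasis n) {S : AmbConfig d L n → ℝ}
    (hS : ContDiff ℝ ∞ S) {F : ℝ → AmbConfig d L n → ℝ}
    (hF : ContDiff ℝ ∞ fun p : ℝ × AmbConfig d L n => F p.1 p.2)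
    {Φ : ℝ → GaugeConfig d L (Matrix.specialUnitaryGroup (Fin n) ℂ) →
      GaugeConfig d L (Matrix.specialUnitaryGroup (Fin n) ℂ)}
    (hΦ : IsFlowMap (fun t W => -linkGrad B (F t) W) Φ) (hmeas : Measurable (Φ 1)) {c : ℝ → ℝ}
    (hsol : ∀ t ∈ Set.Icc (0 : ℝ) 1, ∀ U : GaugeConfig d L (Matrix.specialUnitaryGroup (Fin n) ℂ),
      luscherL B S t (F t) (WilsonFlow.coeConfig U) = S (WilsonFlow.coeConfig U) + c t) :
    IsTrivializingMap
      (fun U : GaugeConfig d L (Matrix.specialUnitaryGroup (Fin n) ℂ) => S (WilsonFlow.coeConfig U))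
      (Φ 1) :=
  isTrivializingMap_of_flowEquation flowGlobalExistence_holds jacobianFormula_holds B hS hF hΦ hmeas hsol

/-- **Gradient flows of gauge-invariant flow actions are gauge equivariant, unconditionally**
(`isGaugeEquivariant_flowMap_of_flowGlobalExistence` + `flowGlobalExistence_holds`).
[cite: Luscher2010Trivializing, §3.1, §4.2 eq. (4.4)] -/
theorem isGaugeEquivariant_flowMap' [NeZero L] (B : SuBasis n) {F : ℝ → AmbConfig d L n → ℝ}
    (hFi : ∀ t, IsGaugeInvariant fun U : GaugeConfig d L (Matrix.specialUnitaryGroup (Fin n) ℂ) =>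
      F t (WilsonFlow.coeConfig U))
    (hFd : ∀ t, Differentiable ℝ (F t))
    (hZ1 : ContDiff ℝ 1 fun p : ℝ × AmbConfig d L n => -linkGrad B (F p.1) p.2)
    (hZt : Generator.IsTangent (fun t W => -linkGrad B (F t) W))
    {Φ : ℝ → GaugeConfig d L (Matrix.specialUnitaryGroup (Fin n) ℂ) →
      GaugeConfig d L (Matrix.specialUnitaryGroup (Fin n) ℂ)}
    (hΦ : IsFlowMap (fun t W => -linkGrad B (F t) W) Φ) (t : ℝ) : IsGaugeEquivariant (Φ t) :=
  isGaugeEquivariant_flowMap_of_flowGlobalExistence flowGlobalExistence_holds B hFi hFd hZ1 hZt hΦ t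

/-- **Lüscher's existence theorem for trivializing flows (§4.2), conditional only on the PDE input**
`TrivializingFlowExists` (solvability of `𝓛_t S̃_t = S + Ċ_t`, App. E): for every smooth action `S` there are
a jointly smooth flow action and a jointly continuous flow `Φ` of `Z_t = -∂S̃_t` on `SU(n)^E` whose time-one
map is trivializing. [cite: Luscher2010Trivializing, §4.2 eqs. (4.4)–(4.10), App. E] -/
theorem exists_isTrivializingMap_flow_of_trivializingFlowExists [NeZero L] (hTF : TrivializingFlowExists d L n)
    (B : SuBasis n) {S : AmbConfig d L n → ℝ} (hS : ContDiff ℝ ∞ S) :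
    ∃ (F : ℝ → AmbConfig d L n → ℝ)
      (Φ : ℝ → GaugeConfig d L (Matrix.specialUnitaryGroup (Fin n) ℂ) →
        GaugeConfig d L (Matrix.specialUnitaryGroup (Fin n) ℂ)),
      ContDiff ℝ ∞ (fun p : ℝ × AmbConfig d L n => F p.1 p.2) ∧
      IsFlowMap (fun t W => -linkGrad B (F t) W) Φ ∧
      Continuous (fun p : ℝ × GaugeConfig d L (Matrix.specialUnitaryGroup (Fin n) ℂ) => Φ p.1 p.2) ∧
      IsTrivializingMap
        (fun U : GaugeConfig d L (Matrix.specialUnitaryGroup (Fin n) ℂ) => S (WilsonFlow.coeConfig U))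
        (Φ 1) :=
  exists_isTrivializingMap_flow hTF flowGlobalExistence_holds jacobianFormula_holds B hS

end Summit.Ventures.LatticeQCDFlow.TrivializingMaps

end
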